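import Mathlib
import HarnessLib
import Summits.HubbardSuperconductivity.HubbardSuperconductivity.Theorems.KLProgrammeKLRegimeTwoVolumeTowerBaseDefs
import Summits.HubbardSuperconductivity.HubbardSuperconductivity.Theorems.KLProgrammeKLRegimeTwoVolumeFrameComposite
import Summits.HubbardSuperconductivity.HubbardSuperconductivity.Theorems.KLProgrammeKLRegimeTwoVolumeNormVKit

/-!
# Route `KLProgramme` — crux K3, VL child `KLRegimeVolumeLimitV17F2` (stmt-HubbardSuperconductivity-20440), blueprint v5 M5 / W4a (frame-swap step): THE FINE
# GRID ACTION AT ITS OWN COVARIANCE FRAME AGAINST THE COMMON COVARIANCE FRAME (seat hubbard-kl-k3c4-p1 g13; `--supports` 20440)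

M4a compares the two volumes' UV-stepped grid actions with the covariance read at the COMMON frame `Kc` on both lattices (counterterms at the own
frames); the true fine base object `klGridAction (bL) M β U μ Kf` has its covariance at the fine frame `Kf`.  The covariance frame swap is the fine-side
composite `…TwoVolumeFrameComposite.sum_norm_kernel_frameComposite_le` with the IDENTITY substitution on both sides (`T = T″ = 1`, so `δ = 0`, `NB = 0`):
`Σ_{Y p = w} ‖kernel (klGridAction (bL) … Kf) Y − kernel (effAction (S_Nᵀ C^{Kc}_{>Λ_1} S_N) (V_N + 𝒩_{Kf})) Y‖ ≤` the `sE, cR, cC` terms of M3f — the `hr` of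
`…TowerBaseGridSplice.tower_base_grid_keyedDefect_splice`.

* **`tower_base_grid_frameSwap_le`**.

Proofs only; no definition.
-/

noncomputable section

namespace Summit.HubbardSuperconductivity.HubbardSuperconductivity.Theorems.TwoVolumeSource

set_option linter.dupNamespace false -- summit = problem name (single-conjunct summit), D-0017

open Finset Literature.MathematicalPhysics.QuantumLattice GrassmannAlgebra Literature.Probability.LatticeModels
  Literature.Probability.LatticeModels.BattleFederbush
open Summit.HubbardSuperconductivity.HubbardSuperconductivity.Theorems.KLProgrammeLegKernels
open Summit.HubbardSuperconductivity.HubbardSuperconductivity.Theorems.KLRegimeSplit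
open Summit.HubbardSuperconductivity.HubbardSuperconductivity.Theorems.EngineV8
open Summit.HubbardSuperconductivity.HubbardSuperconductivity.Theorems.TwoVolumeDefect

set_option maxHeartbeats 400000 in -- the M3f instantiation with the identity substitution
/-- **THE COVARIANCE FRAME SWAP OF THE FINE GRID ACTION** (see the module docstring). [folklore: M3f with the identity substitution;
cite: BenfattoGiulianiMastropietro2006, §3; Salmhofer1999, (2.102)-(2.106)] -/
theorem tower_base_grid_frameSwap_le {V M : ℕ} [NeZero V] [NeZero M] (β U μ : ℝ) (Kc Kf : TrigPolyC4v)
    -- the covariance at the common frame `C`, the frame defect `E = C[Kf] − C[Kc]`: Gram path, rows/columns of `C`, entry sup / rows / columns of `E`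
    {κ : ℝ} (hκ : 0 < κ)
    (hGB : ∀ t ∈ Set.Icc (0 : ℝ) 1, IsGramBoundedR
      ((hubbardGridSub V M β (klGridN M)).transpose * hubbardCovAboveCT V M β μ 0 Kc (klScale klE0 1) * hubbardGridSub V M β (klGridN M) +
        t • ((hubbardGridSub V M β (klGridN M)).transpose * hubbardCovAboveCT V M β μ 0 Kf (klScale klE0 1) * hubbardGridSub V M β (klGridN M) -
          (hubbardGridSub V M β (klGridN M)).transpose * hubbardCovAboveCT V M β μ 0 Kc (klScale klE0 1) * hubbardGridSub V M β (klGridN M))) κ)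
    {αC : ℝ} (hαC : 0 < αC)
    (hrow : ∀ x, ∑ y, ‖((hubbardGridSub V M β (klGridN M)).transpose * hubbardCovAboveCT V M β μ 0 Kc (klScale klE0 1) * hubbardGridSub V M β (klGridN M)) x y‖ ≤ αC)
    (hcol : ∀ y, ∑ x, ‖((hubbardGridSub V M β (klGridN M)).transpose * hubbardCovAboveCT V M β μ 0 Kc (klScale klE0 1) * hubbardGridSub V M β (klGridN M)) x y‖ ≤ αC)
    {sE cR cC : ℝ} (hcR : 0 ≤ cR) (hcC : 0 ≤ cC)
    (hsE : ∀ x y, ‖((hubbardGridSub V M β (klGridN M)).transpose * hubbardCovAboveCT V M β μ 0 Kf (klScale klE0 1) * hubbardGridSub V M β (klGridN M) -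
      (hubbardGridSub V M β (klGridN M)).transpose * hubbardCovAboveCT V M β μ 0 Kc (klScale klE0 1) * hubbardGridSub V M β (klGridN M)) x y‖ ≤ sE)
    (hR : ∀ x, ∑ y, ‖((hubbardGridSub V M β (klGridN M)).transpose * hubbardCovAboveCT V M β μ 0 Kf (klScale klE0 1) * hubbardGridSub V M β (klGridN M) -
      (hubbardGridSub V M β (klGridN M)).transpose * hubbardCovAboveCT V M β μ 0 Kc (klScale klE0 1) * hubbardGridSub V M β (klGridN M)) x y‖ ≤ cR)
    (hCc : ∀ y, ∑ x, ‖((hubbardGridSub V M β (klGridN M)).transpose * hubbardCovAboveCT V M β μ 0 Kf (klScale klE0 1) * hubbardGridSub V M β (klGridN M) -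
      (hubbardGridSub V M β (klGridN M)).transpose * hubbardCovAboveCT V M β μ 0 Kc (klScale klE0 1) * hubbardGridSub V M β (klGridN M)) x y‖ ≤ cC)
    -- the input `V_N + 𝒩_{Kf}`: parity, raw and even plain profiles
    (hXe : hubbardGridInteraction V (klGridN M) β U + hubbardGridCounterQuadratic V (klGridN M) β Kf ∈ evenOdd ℂ 0)
    (hX0 : constPart ℂ (hubbardGridInteraction V (klGridN M) β U + hubbardGridCounterQuadratic V (klGridN M) β Kf) = 0)
    (NX : ℕ → ℝ) (hNX0 : ∀ k, 0 ≤ NX k)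
    (hNX : ∀ (k : ℕ) (p : Fin k) (y : GridLeg (GridPoint V (klGridN M))), ∑ Y ∈ univ.filter (fun Y : Fin k → GridLeg (GridPoint V (klGridN M)) => Y p = y),
      ‖kernel ℂ (hubbardGridInteraction V (klGridN M) β U + hubbardGridCounterQuadratic V (klGridN M) β Kf) k Y‖ ≤ NX k)
    (NW : ℕ → ℝ) (hNW0 : ∀ m', 0 ≤ NW m')
    (hNW : ∀ m' (j : Fin (2 * m')) (x : GridLeg (GridPoint V (klGridN M))), ∑ Y ∈ univ.filter (fun Y : Fin (2 * m') → GridLeg (GridPoint V (klGridN M)) => Y j = x),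
      ‖kernel ℂ (hubbardGridInteraction V (klGridN M) β U + hubbardGridCounterQuadratic V (klGridN M) β Kf) (2 * m') Y‖ ≤ NW m')
    -- one field radius, two smallness conditions (`NB = 0`)
    {ρ : ℝ} (hρ : 0 < ρ) (hθ₁ : Real.exp 1 * (αC + (cR + cC)) * normV (GridLeg (GridPoint V (klGridN M))) κ ρ NW / κ ^ 2 < 1)
    (hθ₂ : Real.exp 1 * αC * normV (GridLeg (GridPoint V (klGridN M))) κ ρ NW / κ ^ 2 < 1)
    (w : GridLeg (GridPoint V (klGridN M))) (n : ℕ) (p : Fin (n + 1)) :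
    ∑ Y ∈ univ.filter (fun Y : Fin (n + 1) → GridLeg (GridPoint V (klGridN M)) => Y p = w),
        ‖kernel ℂ (klGridAction V M β U μ Kf) (n + 1) Y -
          kernel ℂ (effAction ℂ ((hubbardGridSub V M β (klGridN M)).transpose * hubbardCovAboveCT V M β μ 0 Kc (klScale klE0 1) * hubbardGridSub V M β (klGridN M))
            (hubbardGridInteraction V (klGridN M) β U + hubbardGridCounterQuadratic V (klGridN M) β Kf)) (n + 1) Y‖ ≤
      ((((n + 1 + 1) * (n + 1 + 2) : ℕ) : ℝ) / 2 * sE *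
          (ρ⁻¹ ^ (n + 3) * (Real.exp 1 * normV (GridLeg (GridPoint V (klGridN M))) κ ρ NW) /
            (1 - Real.exp 1 * (αC + (cR + cC)) * normV (GridLeg (GridPoint V (klGridN M))) κ ρ NW / κ ^ 2)) +
        ‖(2 : ℂ)⁻¹‖ * ∑ a' ∈ range (n + 2), ∑ b' ∈ range (n + 2),
          (if a' + b' = n + 1 then (((a' + 1) * (b' + 1) : ℕ) : ℝ) *
            (cR * (ρ⁻¹ ^ (a' + 1) * (Real.exp 1 * normV (GridLeg (GridPoint V (klGridN M))) κ ρ NW) /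
                  (1 - Real.exp 1 * (αC + (cR + cC)) * normV (GridLeg (GridPoint V (klGridN M))) κ ρ NW / κ ^ 2)) *
                (ρ⁻¹ ^ (b' + 1) * (Real.exp 1 * normV (GridLeg (GridPoint V (klGridN M))) κ ρ NW) /
                  (1 - Real.exp 1 * (αC + (cR + cC)) * normV (GridLeg (GridPoint V (klGridN M))) κ ρ NW / κ ^ 2)) +
              cC * (ρ⁻¹ ^ (a' + 1) * (Real.exp 1 * normV (GridLeg (GridPoint V (klGridN M))) κ ρ NW) /
                  (1 - Real.exp 1 * (αC + (cR + cC)) * normV (GridLeg (GridPoint V (klGridN M))) κ ρ NW / κ ^ 2)) *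
                (ρ⁻¹ ^ (b' + 1) * (Real.exp 1 * normV (GridLeg (GridPoint V (klGridN M))) κ ρ NW) /
                  (1 - Real.exp 1 * (αC + (cR + cC)) * normV (GridLeg (GridPoint V (klGridN M))) κ ρ NW / κ ^ 2))) else 0)) := by
  classical
  letI : LinearOrder (GridLeg (GridPoint V (klGridN M))) := LinearOrder.lift' (Fintype.equivFin (GridLeg (GridPoint V (klGridN M)))) (Fintype.equivFin _).injective
  set C := (hubbardGridSub V M β (klGridN M)).transpose * hubbardCovAboveCT V M β μ 0 Kc (klScale klE0 1) * hubbardGridSub V M β (klGridN M) with hC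
  set Cf := (hubbardGridSub V M β (klGridN M)).transpose * hubbardCovAboveCT V M β μ 0 Kf (klScale klE0 1) * hubbardGridSub V M β (klGridN M) with hCf
  set X := hubbardGridInteraction V (klGridN M) β U + hubbardGridCounterQuadratic V (klGridN M) β Kf with hXdef
  -- the fine grid action is `effAction (C + (Cf − C)) (map (toLin' 1) X)`
  have hmap1 : ExteriorAlgebra.map (Matrix.toLin' (1 : Matrix (GridLeg (GridPoint V (klGridN M))) (GridLeg (GridPoint V (klGridN M))) ℂ)) X = X := by
    rw [Matrix.toLin'_one, ExteriorAlgebra.map_id, AlgHom.id_apply]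
  have hA' : klGridAction V M β U μ Kf = effAction ℂ (C + (Cf - C))
      (ExteriorAlgebra.map (Matrix.toLin' (1 : Matrix (GridLeg (GridPoint V (klGridN M))) (GridLeg (GridPoint V (klGridN M))) ℂ)) X) := by
    rw [hmap1, add_sub_cancel]; rfl
  have hB' : effAction ℂ C X = effAction ℂ C
      (ExteriorAlgebra.map (Matrix.toLin' (1 : Matrix (GridLeg (GridPoint V (klGridN M))) (GridLeg (GridPoint V (klGridN M))) ℂ)) X) := by rw [hmap1]
  rw [hA', hB']
  -- the identity substitution's data
  have h1n : ∀ x y : GridLeg (GridPoint V (klGridN M)), ‖(1 : Matrix (GridLeg (GridPoint V (klGridN M))) (GridLeg (GridPoint V (klGridN M))) ℂ) x y‖ ≤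
      (if x = y then (1 : ℝ) else 0) := fun x y => by
    rw [Matrix.one_apply]; split_ifs <;> simp
  have hcol1 : ∀ y : GridLeg (GridPoint V (klGridN M)), ∑ x, (if x = y then (1 : ℝ) else 0) ≤ 1 := fun y => by rw [sum_ite_eq' univ y]; simp
  have hrow1 : ∀ x : GridLeg (GridPoint V (klGridN M)), ∑ y, (if x = y then (1 : ℝ) else 0) ≤ 1 := fun x => by rw [sum_ite_eq univ x]; simp
  have hδ1 : ∀ y : GridLeg (GridPoint V (klGridN M)), ∑ x, ‖(1 : Matrix (GridLeg (GridPoint V (klGridN M))) (GridLeg (GridPoint V (klGridN M))) ℂ) x y -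
      (1 : Matrix _ _ ℂ) x y‖ ≤ 0 := fun y => by simp
  have hδ1' : ∀ x : GridLeg (GridPoint V (klGridN M)), ∑ y, ‖(1 : Matrix (GridLeg (GridPoint V (klGridN M))) (GridLeg (GridPoint V (klGridN M))) ℂ) x y -
      (1 : Matrix _ _ ℂ) x y‖ ≤ 0 := fun x => by simp
  -- `NB = 0`
  have hNB0 : ∀ m', (fun _ : ℕ => (0 : ℝ)) m' = (2 * m' : ℕ) * (1 : ℝ) ^ (2 * m' - 1) * 0 * NX (2 * m') := fun m' => by simp
  have hN0 : normV (GridLeg (GridPoint V (klGridN M))) κ ρ (fun m' => NW m' + (fun _ : ℕ => (0 : ℝ)) m') = normV (GridLeg (GridPoint V (klGridN M))) κ ρ NW := by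
    simp only [add_zero]
  have hN00 : normV (GridLeg (GridPoint V (klGridN M))) κ ρ (fun _ : ℕ => (0 : ℝ)) = 0 := normV_zero_fun κ ρ
  have hθ₁' : Real.exp 1 * (αC + (cR + cC)) * normV (GridLeg (GridPoint V (klGridN M))) κ ρ (fun m' => NW m' + (fun _ : ℕ => (0 : ℝ)) m') / κ ^ 2 < 1 := by
    rw [hN0]; exact hθ₁
  have hθ₂' : Real.exp 1 * αC * (normV (GridLeg (GridPoint V (klGridN M))) κ ρ NW + normV (GridLeg (GridPoint V (klGridN M))) κ ρ (fun _ : ℕ => (0 : ℝ))) / κ ^ 2 < 1 := by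
    rw [hN00, add_zero]; exact hθ₂
  -- (the filter / `DecidableEq` instances of M3f's Γ'-side come from the local linear order: bridge them with `convert`)
  have h := sum_norm_kernel_frameComposite_le C (Cf - C) 1 1 X hXe hX0 hκ hGB hαC hrow hcol hsE hcR hcC hR hCc (fun x y => if x = y then (1 : ℝ) else 0)
    zero_le_one le_rfl h1n h1n hcol1 hrow1 hδ1 hδ1' NX hNX0 (fun k p' y => by convert hNX k p' y using 2)
    NW hNW0 (fun m' j x => by rw [hmap1]; convert hNW m' j x using 3) (fun _ => 0) hNB0 hρ hθ₁' hθ₂' w n p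
  rw [hN0, hN00] at h
  have hrhs : ρ⁻¹ ^ (n + 1) * (Real.exp 1 * 0) /
      (1 - Real.exp 1 * αC * (normV (GridLeg (GridPoint V (klGridN M))) κ ρ NW + 0) / κ ^ 2) ^ 2 = 0 := by
    simp only [mul_zero, zero_div]
  rw [hrhs, add_zero] at h
  convert h using 3

end Summit.HubbardSuperconductivity.HubbardSuperconductivity.Theorems.TwoVolumeSource

end
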